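import Literature.MathematicalPhysics.KineticTheory.PureQuarticChainConfined
import Literature.MathematicalPhysics.KineticTheory.PureQuarticChainHormander
import Literature.Probability.Process.KrylovBogoliubov
import HarnessLib

/-!
# The purely quartic chain: its Langevin transition semigroup, and CEHR Thm 2.13's weak corollary from H2

Topic `Literature/MathematicalPhysics/KineticTheory`. First proof file of the provefact unit for
the named fact `CuneoEckmannHairerReyBellet2018_pureQuarticChain` (`PureQuarticChainNESS.lean`:
Cuneo–Eckmann–Hairer–Rey-Bellet 2018, Theorem 2.13, weak-stationarity corollary, for the purely
quartic chain `pureQuarticChain μ γ = ⟨U = μq⁴/4, V = r⁴/4, γ⟩`, `μ, γ > 0`). It mirrors the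
architecture of the tree's proof for the pinned chain (`LangevinChainNESSHolds.lean` and its
imports) on the MODEL-FREE SDE pipeline of `LangevinChainConfined.lean`, and reduces the fact to
the single deep input of the printed proof that is chain-specific, the Lyapunov condition **H2**
(CEHR Thm 5.1 / Rem 5.2) for THIS chain — everything else is PROVED here or imported:

* the purely quartic chain has confining potentials (`pureQuarticChain_isConfining`,
  `PureQuarticChainConfined.lean`, sibling unit for `CuneoEckmannHairerReyBellet2018_thm213_pureQuartic`,
  with the elementary energy inequalities of `PureQuarticEnergy.lean`), hence (imported) the
  transition semigroup `IsConfining.semigroup` of the SDE (2.2) with the Feller property, Dynkin's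
  identity and the a-priori bound (3.4) (`LangevinChainExpBound.lean`);
* absolute continuity of weak steady states (`pureQuarticChain_absolutelyContinuous_of_isSteadyState`):
  `V = r⁴/4` is non-degenerate in the pointwise sense (fourth derivative `6`; CEHR Example 2.5,
  `rbNondegenerate_pureQuarticChain_V` of the sibling file `PureQuarticChainHormander.lean`), so
  the bracket condition and the smooth density of weakly stationary measures hold
  (`LangevinChainDegenerateHormander.lean`, Hörmander's Thm 1.1 being proved in the tree,
  `Literature.Analysis.Hypoelliptic.hormander1967_thm11_proof`);
* generic, for every chain with confining potentials: `IsConfining.abs_bondCurrent_le`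
  (`|j_i| ≤ N B (N/2+1)(1+H)²`), `IsConfining.integrable_bondCurrent_of_integrable_exp`,
  `IsConfining.isSteadyState_of_isInvariant` (invariant probability measures with an exponential
  moment are weak steady states: Dynkin), `IsConfining.exists_isInvariant_of_H2` (**CEHR
  Thm 2.13 (2) / Prop. 3.7 from H2**: the Krylov–Bogoliubov theorem of `KrylovBogoliubov.lean`
  applied to the whole family `(e^{ϑH})_{0<ϑ<1/T_max}` at once, orbit integrals bounded by H2 at
  `t* = 1` and (3.4) on `[0, 1)` — ONE invariant probability measure integrating every `e^{ϑH}`);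
* `CuneoEckmannHairerReyBellet2018_pureQuarticChain_of_H2` — **the fact from H2**, H2 being
  spelled out as an explicit hypothesis about the constructed kernels
  `(pureQuarticChain μ γ).langevinKernel N T_L T_R 1` (no new named fact, D-0026): for every
  `0 < θ < 1/max(T_L,T_R)` there are `κ ∈ [0,1)`, `c ≥ 0` with
  `∫ e^{θH} dP_1(z, ·) ≤ κ e^{θH(z)} + c` (Remark 5.2 at `t* = 1`, the compact set absorbed in `c`).

The proof of that hypothesis for the purely quartic chain (CEHR §5.1: `ℓ_i = ℓ_p = 4`, only the
interaction regime; the deterministic core — uniform dissipation of the limiting quartic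
Hamiltonian chain `limitChain μ 1` on an energy shell — is `LangevinChainLimitFlow.lean`) is the
subject of the sequel of this unit.

## References

* N. Cuneo, J.-P. Eckmann, M. Hairer, L. Rey-Bellet, *Non-equilibrium steady states for networks
  of oscillators*, EJP **23** (2018) no. 55 (arXiv:1712.09413): Thm 2.13, Example 2.5, §3
  eqs. (3.3)–(3.6), Prop. 3.2, Prop. 3.7, Prop. 4.1, Thm 5.1, Rem 5.2.
* R. Khasminskii, *Stochastic Stability of Differential Equations* (2nd ed., 2012), Thm 3.5, §3.4.
-/

noncomputable section

open MeasureTheory ProbabilityTheory Filter Topology Set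
open scoped NNReal ENNReal ContDiff BoundedContinuousFunction

namespace Literature.MathematicalPhysics.KineticTheory.HeatConduction

open Literature.Probability.Process Literature.Analysis.Distribution

variable {N : ℕ}

/-! ### Generic: chains with confining potentials -/

namespace OscillatorChain.IsConfining

variable {P : OscillatorChain} {T_L T_R : ℝ}

/-- The Lyapunov functions `e^{θH}` (`θ > 0`) of a chain with confining potentials have compact
sublevel sets (`H` has). [folklore] -/
theorem isCompact_setOf_exp_hamiltonian_le (hP : P.IsConfining) (N : ℕ) {θ : ℝ} (hθ : 0 < θ)
    (R : ℝ≥0) :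
    IsCompact {x : PhaseSpace N | (Real.exp (θ * P.hamiltonian N x)).toNNReal ≤ R} := by
  have hcont : Continuous fun x : PhaseSpace N => (Real.exp (θ * P.hamiltonian N x)).toNNReal :=
    continuous_real_toNNReal.comp (Real.continuous_exp.comp
      (continuous_const.mul (hP.differentiable_hamiltonian N).continuous))
  refine (hP.isCompact_setOf_hamiltonian_le N
    (Real.log (max (R : ℝ) 1) / θ)).of_isClosed_subset (isClosed_le hcont continuous_const) ?_
  intro x hx
  rw [mem_setOf_eq, Real.toNNReal_le_iff_le_coe] at hx
  rw [mem_setOf_eq, le_div_iff₀ hθ, mul_comm, Real.le_log_iff_exp_le (by positivity)]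
  exact hx.trans (le_max_left _ _)

/-- **Polynomial bound on the bond currents** of a chain with confining potentials:
`|j_i| ≤ N B (N/2 + 1) (1 + H)²` (`|V'| ≤ B(1+V)`, `V(q_{i+1}-q_i) ≤ H`, `∑|p_k| ≤ N/2 + H`).
[folklore] -/
theorem abs_bondCurrent_le (hP : P.IsConfining) (N : ℕ) (i : Fin N) (x : PhaseSpace N) :
    |P.bondCurrent N i x| ≤
      N * (hP.forceConstV * (((N : ℝ) / 2 + 1) * (1 + P.hamiltonian N x) ^ 2)) := by
  obtain ⟨hB0, hB⟩ := hP.forceConstV_spec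
  set B := hP.forceConstV with hBdef
  set H := P.hamiltonian N x with hHdef
  have hH0 : 0 ≤ H := hP.hamiltonian_nonneg N x
  have hmom := P.sum_abs_momentum_le hP.U_nonneg hP.V_nonneg N x
  have habs : ∀ k : Fin N, |x.2 k| ≤ (N : ℝ) / 2 + H := fun k =>
    (Finset.single_le_sum (f := fun k => |x.2 k|) (fun k _ => abs_nonneg _)
      (Finset.mem_univ k)).trans hmom
  unfold OscillatorChain.bondCurrent
  have hterm : ∀ j : Fin N, |(if j.val = i.val + 1 then
      -((x.2 i + x.2 j) / 2 * deriv P.V (x.1 j - x.1 i)) else 0)| ≤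
      B * (((N : ℝ) / 2 + 1) * (1 + H) ^ 2) := by
    intro j
    split_ifs with hj
    · rw [abs_neg, abs_mul, abs_div, abs_two]
      have hp : |x.2 i + x.2 j| / 2 ≤ (N : ℝ) / 2 + H := by
        have := abs_add_le (x.2 i) (x.2 j)
        have := habs i
        have := habs j
        linarith
      have hv : |deriv P.V (x.1 j - x.1 i)| ≤ B * (1 + H) := by
        refine (hB _).trans (mul_le_mul_of_nonneg_left ?_ hB0)
        have := P.bond_le_hamiltonian hP.U_nonneg hP.V_nonneg N x hj
        linarith
      calc |x.2 i + x.2 j| / 2 * |deriv P.V (x.1 j - x.1 i)|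
          ≤ ((N : ℝ) / 2 + H) * (B * (1 + H)) :=
            mul_le_mul hp hv (abs_nonneg _) (by positivity)
        _ ≤ (((N : ℝ) / 2 + 1) * (1 + H)) * (B * (1 + H)) := by
            refine mul_le_mul_of_nonneg_right ?_ (by positivity)
            have hN0 : (0 : ℝ) ≤ N := Nat.cast_nonneg N
            nlinarith [mul_nonneg hN0 hH0]
        _ = B * (((N : ℝ) / 2 + 1) * (1 + H) ^ 2) := by ring
    · rw [abs_zero]; positivity
  calc |∑ j : Fin N, (if j.val = i.val + 1 then
          -((x.2 i + x.2 j) / 2 * deriv P.V (x.1 j - x.1 i)) else 0)|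
      ≤ ∑ j : Fin N, |(if j.val = i.val + 1 then
          -((x.2 i + x.2 j) / 2 * deriv P.V (x.1 j - x.1 i)) else 0)| :=
        Finset.abs_sum_le_sum_abs _ _
    _ ≤ ∑ _j : Fin N, B * (((N : ℝ) / 2 + 1) * (1 + H) ^ 2) := Finset.sum_le_sum fun j _ => hterm j
    _ = N * (B * (((N : ℝ) / 2 + 1) * (1 + H) ^ 2)) := by
        simp [Finset.sum_const, Finset.card_univ, Fintype.card_fin]

/-- The bond currents of a chain with confining (`C²`) potentials are continuous. [folklore] -/
theorem continuous_bondCurrent (hP : P.IsConfining) (N : ℕ) (i : Fin N) :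
    Continuous (P.bondCurrent N i) := by
  have hV' : Continuous (deriv P.V) := (hP.contDiff_V.continuous_deriv (by norm_num))
  unfold OscillatorChain.bondCurrent
  refine continuous_finsetSum _ fun j _ => ?_
  by_cases h : j.val = i.val + 1
  · simp only [h, if_true]
    exact ((((continuous_apply i).comp continuous_snd).add
      ((continuous_apply j).comp continuous_snd)).div_const 2 |>.mul
      (hV'.comp (((continuous_apply j).comp continuous_fst).sub
        ((continuous_apply i).comp continuous_fst)))).neg
  · simp only [h, if_false]
    exact continuous_const

/-- **Exponential moments dominate the currents**: if `e^{ϑH} ∈ L¹(m)` for some `ϑ > 0`, the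
bond currents of a chain with confining potentials are `m`-integrable
(`|j_i| ≤ C (1 + H)² ≤ C' e^{ϑH}`). [folklore] -/
theorem integrable_bondCurrent_of_integrable_exp (hP : P.IsConfining) (N : ℕ)
    {m : Measure (PhaseSpace N)} {ϑ : ℝ} (hϑ : 0 < ϑ)
    (hint : Integrable (fun x => Real.exp (ϑ * P.hamiltonian N x)) m) (i : Fin N) :
    Integrable (P.bondCurrent N i) m := by
  have hB0 : 0 ≤ hP.forceConstV := hP.forceConstV_spec.1
  refine (hint.const_mul (N * (hP.forceConstV * ((N : ℝ) / 2 + 1)) *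
    (2 * Real.exp ϑ / ϑ ^ 2))).mono' (hP.continuous_bondCurrent N i).aestronglyMeasurable
    (Filter.Eventually.of_forall fun x => ?_)
  have hH0 := hP.hamiltonian_nonneg N x
  have hj := hP.abs_bondCurrent_le N i x
  have hsq := one_add_sq_le_exp hH0 hϑ
  rw [Real.norm_eq_abs]
  calc |P.bondCurrent N i x|
      ≤ N * (hP.forceConstV * (((N : ℝ) / 2 + 1) * (1 + P.hamiltonian N x) ^ 2)) := hj
    _ = N * (hP.forceConstV * ((N : ℝ) / 2 + 1)) * (1 + P.hamiltonian N x) ^ 2 := by ring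
    _ ≤ N * (hP.forceConstV * ((N : ℝ) / 2 + 1)) *
          (2 * Real.exp ϑ / ϑ ^ 2 * Real.exp (ϑ * P.hamiltonian N x)) :=
        mul_le_mul_of_nonneg_left hsq (by positivity)
    _ = N * (hP.forceConstV * ((N : ℝ) / 2 + 1)) * (2 * Real.exp ϑ / ϑ ^ 2) *
          Real.exp (ϑ * P.hamiltonian N x) := by ring

/-- **Invariant probability measures with an exponential moment are weak steady states**: for a
chain with confining potentials, every invariant probability measure of a Langevin-chain semigroup
of `P` (interface `LangevinChainSemigroup`, in particular the constructed `IsConfining.semigroup`)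
which integrates `e^{ϑH}` for some `ϑ > 0` is an `OscillatorChain.IsSteadyState` (weak
stationarity by Dynkin's identity and invariance, `LangevinChainSemigroup.IsInvariant.isSteadyState`;
bond currents integrable by the previous lemma). [cite: CuneoEckmannHairerReyBellet2018, §3 and Thm 2.13] -/
theorem isSteadyState_of_isInvariant (hP : P.IsConfining) (N : ℕ)
    (S : LangevinChainSemigroup P N T_L T_R) {m : Measure (PhaseSpace N)} [IsProbabilityMeasure m]
    (hm : S.IsInvariant m) {ϑ : ℝ} (hϑ : 0 < ϑ)
    (hint : Integrable (fun x => Real.exp (ϑ * P.hamiltonian N x)) m) :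
    P.IsSteadyState N T_L T_R m :=
  hm.isSteadyState S (hP.contDiff_U.of_le (by norm_num)) (hP.contDiff_V.of_le (by norm_num))
    (hP.integrable_bondCurrent_of_integrable_exp N hϑ hint)

/-- **CEHR Theorem 2.13 (2) / Prop. 3.7 for the transition semigroup of a chain with confining
potentials, from H2 at `t* = 1`** (Krylov–Bogoliubov): if the potentials are smooth,
`N ≥ 1`, `T_L, T_R > 0`, and for every `0 < θ < 1/max(T_L,T_R)` there are `κ ∈ [0,1)`, `c ≥ 0`
with `∫ e^{θH} dP_1(z, ·) ≤ κ e^{θH(z)} + c` for all `z` (H2 for the constructed kernels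
`langevinKernel`), then `IsConfining.semigroup` has an invariant probability measure under which
`e^{ϑH}` is integrable for EVERY `0 < ϑ < 1/max(T_L, T_R)`: one measure for all `ϑ`, the
Krylov–Bogoliubov theorem of `KrylovBogoliubov.lean` being applied to the whole family of Lyapunov
functions, whose orbit integrals are bounded by H2 at `t* = 1`, the a-priori bound (3.4) on
`[0, 1)` (`LangevinChainSemigroup.lintegral_exp_mul_hamiltonian_le`) and (3.5)–(3.6).
[cite: CuneoEckmannHairerReyBellet2018, Thm 2.13 (2) and Prop 3.7] -/
theorem exists_isInvariant_of_H2 (hP : P.IsConfining) (hU : ContDiff ℝ ∞ P.U)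
    (hV : ContDiff ℝ ∞ P.V) (hN : 0 < N) (hL : 0 < T_L) (hR : 0 < T_R)
    (h2 : ∀ θ : ℝ, 0 < θ → θ < 1 / max T_L T_R →
      ∃ κ c : ℝ, 0 ≤ κ ∧ κ < 1 ∧ 0 ≤ c ∧
        ∀ z : PhaseSpace N,
          ∫⁻ y, ENNReal.ofReal (Real.exp (θ * P.hamiltonian N y))
              ∂(P.langevinKernel N T_L T_R 1 z) ≤
            ENNReal.ofReal (κ * Real.exp (θ * P.hamiltonian N z) + c)) :
    ∃ m : Measure (PhaseSpace N), IsProbabilityMeasure m ∧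
      (hP.semigroup N T_L T_R hN hL.le hR.le).IsInvariant m ∧
      ∀ ϑ : ℝ, 0 < ϑ → ϑ < 1 / max T_L T_R →
        Integrable (fun x => Real.exp (ϑ * P.hamiltonian N x)) m := by
  set S := hP.semigroup N T_L T_R hN hL.le hR.le with hS
  have hF : ∀ (t : ℝ≥0) (g : PhaseSpace N →ᵇ ℝ), Continuous (S.act t g) :=
    hP.continuous_act_semigroup N T_L T_R hN hL.le hR.le
  have hHc : Continuous (P.hamiltonian N) := (hP.differentiable_hamiltonian N).continuous
  have hm0 : 0 < max T_L T_R := lt_max_of_lt_left hL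
  have hTm : 0 < 1 / max T_L T_R := by positivity
  have hγTT : 0 ≤ P.γ * (T_L + T_R) := mul_nonneg hP.γ_nonneg (by linarith)
  -- the family of Lyapunov functions `e^{ϑH}`, `0 < ϑ < 1/T_max`
  let ι := {ϑ : ℝ // 0 < ϑ ∧ ϑ < 1 / max T_L T_R}
  let V : ι → PhaseSpace N → ℝ≥0 := fun ϑ x => (Real.exp (ϑ.1 * P.hamiltonian N x)).toNNReal
  have hVapply : ∀ (ϑ : ι) (x : PhaseSpace N),
      (V ϑ x : ℝ≥0∞) = ENNReal.ofReal (Real.exp (ϑ.1 * P.hamiltonian N x)) := fun ϑ x => rfl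
  have hVc : ∀ ϑ : ι, Continuous (V ϑ) := fun ϑ =>
    continuous_real_toNNReal.comp (Real.continuous_exp.comp (continuous_const.mul hHc))
  -- H2 at `t* = 1` and (3.4) on `[0,1)`, in the form consumed by the abstract theorem
  have hlyap : ∀ ϑ : ι, ∃ (tstar : ℝ≥0) (a b c : ℝ≥0∞), 0 < tstar ∧ a < 1 ∧ b ≠ ⊤ ∧ c ≠ ⊤ ∧
      (∀ x, ∫⁻ y, V ϑ y ∂(S.kernel tstar x) ≤ a * V ϑ x + b) ∧
      (∀ r : ℝ≥0, r < tstar → ∀ x, ∫⁻ y, V ϑ y ∂(S.kernel r x) ≤ c * V ϑ x) := by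
    intro ϑ
    obtain ⟨a, c, ha0, ha1, hc, hbound⟩ := h2 ϑ.1 ϑ.2.1 ϑ.2.2
    have hθm : ϑ.1 * max T_L T_R ≤ 1 := ((lt_div_iff₀ hm0).1 ϑ.2.2).le
    have hθL : ϑ.1 * T_L ≤ 1 := (mul_le_mul_of_nonneg_left (le_max_left _ _) ϑ.2.1.le).trans hθm
    have hθR : ϑ.1 * T_R ≤ 1 := (mul_le_mul_of_nonneg_left (le_max_right _ _) ϑ.2.1.le).trans hθm
    refine ⟨1, ENNReal.ofReal a, ENNReal.ofReal c,
      ENNReal.ofReal (Real.exp (ϑ.1 * P.γ * (T_L + T_R))), one_pos,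
      ENNReal.ofReal_lt_one.2 ha1, ENNReal.ofReal_ne_top, ENNReal.ofReal_ne_top,
      fun x => ?_, fun r hr x => ?_⟩
    · rw [hS, semigroup_kernel]
      refine (hbound x).trans (le_of_eq ?_)
      rw [hVapply, ← ENNReal.ofReal_mul ha0, ← ENNReal.ofReal_add (by positivity) hc]
    · refine (S.lintegral_exp_mul_hamiltonian_le hU hV hN hP.γ_nonneg hL.le hR.le
        (hP.isCompact_setOf_hamiltonian_le N) ϑ.2.1.le hθL hθR r x).trans ?_
      rw [hVapply, ← ENNReal.ofReal_mul (by positivity)]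
      refine ENNReal.ofReal_le_ofReal (mul_le_mul_of_nonneg_right ?_ (by positivity))
      refine Real.exp_le_exp.2 ?_
      have hr' : ((r : ℝ≥0) : ℝ) ≤ 1 := by exact_mod_cast hr.le
      have h0 : 0 ≤ ϑ.1 * P.γ * (T_L + T_R) := by
        have := ϑ.2.1
        rw [mul_assoc]
        exact mul_nonneg this.le hγTT
      nlinarith
  -- a distinguished index with compact sublevel sets
  let ϑ₀ : ι := ⟨1 / max T_L T_R / 2, by positivity, half_lt_self hTm⟩
  have hcpt : ∀ R : ℝ≥0, IsCompact {x | V ϑ₀ x ≤ R} := fun R =>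
    hP.isCompact_setOf_exp_hamiltonian_le N (θ := ϑ₀.1) (by positivity) R
  obtain ⟨m, hm, hinv, hfin⟩ := MarkovSemigroup.exists_invariant_of_lyapunov S.kernel
    S.kernel_zero S.kernel_add S.measurable_kernel hF V hVc hlyap ϑ₀ hcpt 0
  refine ⟨m, hm, hinv, fun ϑ h0 h1 => ?_⟩
  refine ⟨(Real.continuous_exp.comp (continuous_const.mul hHc)).aestronglyMeasurable, ?_⟩
  have hlt := hfin ⟨ϑ, h0, h1⟩
  simp only [hVapply] at hlt
  show ∫⁻ x, ‖Real.exp (ϑ * P.hamiltonian N x)‖ₑ ∂m < ⊤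
  simpa only [Real.enorm_eq_ofReal (Real.exp_nonneg _)] using hlt

end OscillatorChain.IsConfining

/-! ### The purely quartic chain: the fact from H2 -/

section PureQuartic

variable {μ γ : ℝ}

/-- **A weak steady state of the purely quartic chain is absolutely continuous** with respect to
Lebesgue measure (`μ` arbitrary, `γ > 0`, `N ≥ 1`, `T_L > 0`, `T_R ≥ 0`): hypoellipticity of `L*`
(Hörmander 1967 Thm 1.1, proved in the tree) with the bracket condition for the degenerate coupling
`V = r⁴/4` (`LangevinChainDegenerateHormander.lean`).
[cite: Hormander1967, Thm 1.1] [cite: CuneoEckmannHairerReyBellet2018, Prop 3.2 and Prop 4.1] -/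
theorem pureQuarticChain_absolutelyContinuous_of_isSteadyState (μ : ℝ) (hγ : 0 < γ) (hN : 0 < N)
    {T_L T_R : ℝ} (hL : 0 < T_L) (hR : 0 ≤ T_R) {m : Measure (PhaseSpace N)}
    (hm : (pureQuarticChain μ γ).IsSteadyState N T_L T_R m) :
    m ≪ (volume : Measure (PhaseSpace N)) :=
  (pureQuarticChain μ γ).absolutelyContinuous_of_isSteadyState_of_rbNondegenerate
    Literature.Analysis.Hypoelliptic.hormander1967_thm11_proof (pureQuarticChain_contDiff_U μ γ)
    (pureQuarticChain_contDiff_V μ γ) (rbNondegenerate_pureQuarticChain_V μ γ)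
    (by rwa [pureQuarticChain_γ]) hN hL hR hm

/-- **`CuneoEckmannHairerReyBellet2018_pureQuarticChain` from H2.** If for the purely quartic
chain (`μ, γ > 0`, `N ≥ 1`, `T_L, T_R > 0`) the Lyapunov condition H2 of CEHR (Thm 5.1 / Rem 5.2
at `t* = 1`, compact set absorbed in the constant) holds for the constructed transition kernels
`langevinKernel` of the SDE (2.2) — for every `0 < θ < 1/max(T_L,T_R)` some `κ ∈ [0,1)`, `c ≥ 0`
with `∫ e^{θH} dP_1(z, ·) ≤ κ e^{θH(z)} + c` for all `z` — then the named fact holds: the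
invariant probability measure of `IsConfining.semigroup` from `exists_isInvariant_of_H2`
integrates every `e^{ϑH}`, is a weak steady state (`isSteadyState_of_isInvariant`), and is
absolutely continuous (`pureQuarticChain_absolutelyContinuous_of_isSteadyState`).
[cite: CuneoEckmannHairerReyBellet2018, Thm 2.13] -/
theorem CuneoEckmannHairerReyBellet2018_pureQuarticChain_of_H2
    (h2 : ∀ μ γ : ℝ, 0 < μ → 0 < γ →
      ∀ (N : ℕ) (T_L T_R : ℝ), 0 < N → 0 < T_L → 0 < T_R →
        ∀ θ : ℝ, 0 < θ → θ < 1 / max T_L T_R →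
          ∃ κ c : ℝ, 0 ≤ κ ∧ κ < 1 ∧ 0 ≤ c ∧
            ∀ z : PhaseSpace N,
              ∫⁻ y, ENNReal.ofReal (Real.exp (θ * (pureQuarticChain μ γ).hamiltonian N y))
                  ∂((pureQuarticChain μ γ).langevinKernel N T_L T_R 1 z) ≤
                ENNReal.ofReal (κ * Real.exp (θ * (pureQuarticChain μ γ).hamiltonian N z) + c)) :
    CuneoEckmannHairerReyBellet2018_pureQuarticChain := by
  intro μ γ hμ hγ N T_L T_R hN hL hR
  have hP : (pureQuarticChain μ γ).IsConfining := pureQuarticChain_isConfining hμ hγ.le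
  obtain ⟨m, hm, hinv, hint⟩ := hP.exists_isInvariant_of_H2 (pureQuarticChain_contDiff_U μ γ)
    (pureQuarticChain_contDiff_V μ γ) hN hL hR (h2 μ γ hμ hγ N T_L T_R hN hL hR)
  have hmax : 0 < max T_L T_R := lt_max_of_lt_left hL
  have hϑ0 : 0 < 1 / max T_L T_R / 2 := by positivity
  have hϑ1 : 1 / max T_L T_R / 2 < 1 / max T_L T_R := half_lt_self (by positivity)
  have hss : (pureQuarticChain μ γ).IsSteadyState N T_L T_R m :=
    hP.isSteadyState_of_isInvariant N _ hinv hϑ0 (hint _ hϑ0 hϑ1)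
  exact ⟨m, hss, pureQuarticChain_absolutelyContinuous_of_isSteadyState μ hγ hN hL hR.le hss, hint⟩

end PureQuartic

end Literature.MathematicalPhysics.KineticTheory.HeatConduction
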